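import Summits.QuantumFields.BalabanUV.Beta.EriceFlowEnclosureB12AsPrintedHistoryContagionShiftFlowZeroSemigroup

/-!
# Beta / EriceFlowEnclosureB12AsPrintedHistoryContagionShiftFlowZeroSemigroupExact — ASYMPTOTIC FREEDOM IS CONTAGIOUS, part 52: THE EXACTLY SOLUBLE CASE — FOR THE TRIVIAL
# ONE-LOOP FUNCTIONAL THE CANONICAL CONTINUOUS RG IS THE TEXTBOOK RUNNING COUPLING `1∕g(s)² = 1∕g² + s·β₀`.  A def-free sanity companion of parts 44–47: the memoryless
# constant functional `B ≡ 1` (β₀ = 1; memory profile with `C_m = 0`, so κ = 0) on any box.  §81: EVERY box solution from a pin e is EXACT, `1∕h(m)² = 1∕e² + m`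
# (`const_invSq_eq`); the dynamical Abel function against the reference pin e′ (comparison sequence `a(n) = 1∕e′² + n`) is EXACTLY **`Λ g = 1∕g² − 1∕e′²`**
# (`const_dynAbel`) — strictly antitone, onto `[0, ∞[` (`const_strictAntiOn ∕ const_onto`), and EXACTLY chart-isometric (`const_isometry_exact`: part 44's defect
# `κ·g̃·Δ` vanishes with C_m); and part 46's semigroup `Λ⁻¹∘(Λ + s)` is, in closed form, **`φ_s g = 1∕√(1∕g² + s)`** (`const_rg_eq`) — THE TEXTBOOK ONE-LOOP RUNNING COUPLING,
# with `φ_{1∕2} g = 1∕√(1∕g² + ½)` HALF A STEP and the continuous clock `s·φ_s(g)² = s∕(1∕g² + s) → 1` holding in closed form (`const_clock`).  So the abstract hypotheses of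
# §71 ∕ §73 ∕ §79 are inhabited with equalities, and the canonical interpolation of parts 46–47 reduces, when the memory is switched off, to what every textbook writes.
# Abstract (β-flow team, prover 1, unit `b2b-balaban-beta-bflow-p1`, gen 40; ROW AP-I·Uc × NODE U2 × ROW Λ — exactly soluble companion)

HONEST FRAMING (page 1 of everything the β sub-cell writes): discharging `BetaPertH` makes Bałaban's UV stability UNCONDITIONAL — a
real constructive-QFT result; it is NOT the continuum limit and NOT the Clay problem.  HONEST DEPENDENCY (cell reorg 2026-08-19,
verbatim): «continuum YM on T⁴ ⇐ BetaPertH ∧ nine spine estimates (0/9 proved); BetaPertH ⇐ (D1) ∧ (D4) ∧ CAP+tail; G-an2-4 gates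
asym, D1 and NE2/3/4.»  THIS MODULE DISCHARGES NOTHING: a TOY (the constant functional `u ↦ 1`, def-free) — NOT Bałaban's β, which has memory and whose one-loop structure at
the zero history is NOT PRINTED for the functional ([I] p. 298); node U2's `T4BetaStationary.{SeqBox, MemoryProfile}`, `T4BetaFlowWellPosed.{MemFlow, one_div_sq_one_div_sqrt}`,
part 46's `rg_mem_eq` and Mathlib's `Function.invFunOn` BY NAME — nothing restated.  [I] = T. Bałaban, Commun. Math. Phys. **109** (1987) 249–301 [Balaban1987RG1].

WHAT THIS FILE PROVES (0 sorry, 0 def): §81 `const_memoryProfile`, `const_valueAtZero`, **`const_invSq_eq`**, **`const_dynAbel`**, `const_strictAntiOn`, `const_onto`,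
`const_isometry_exact`, **`const_rg_eq`**, `const_clock`.  NOT CLAIMED: anything about Bałaban's β; `BetaPertH`; continuum; Clay.
-/

namespace Summit.QuantumFields.BalabanUV.Beta.EriceFlowEnclosureB12AsPrintedHistoryContagionShiftFlowZeroSemigroupExact

open Filter Topology Set Function
open Literature.MathematicalPhysics.QuantumFieldTheory.Balaban1983to89
open Literature.MathematicalPhysics.QuantumFieldTheory.Balaban1983to89.T4BetaStationary (SeqBox MemoryProfile)
open Literature.MathematicalPhysics.QuantumFieldTheory.Balaban1983to89.T4BetaFlowWellPosed (MemFlow one_div_sq_one_div_sqrt)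
open Summit.QuantumFields.BalabanUV.Beta.EriceFlowEnclosureB12AsPrintedHistoryContagionShiftFlowZeroSemigroup (rg_mem_eq)

noncomputable section

/-! ## §81 The trivial one-loop functional `B ≡ 1`: exact trajectories, exact Λ, exact continuous RG -/

/-- The constant functional has a memory profile with `C_m = 0` (any θ, any box). [folklore] -/
theorem const_memoryProfile {θ γ : ℝ} : MemoryProfile 0 θ γ (fun _ : ℕ → ℝ => (1 : ℝ)) := by
  intro u u' _ _
  simp

/-- Its value at the zero history is β₀ = 1, with modulus constant 0. [folklore] -/
theorem const_valueAtZero {θ γ : ℝ} : ∀ u : ℕ → ℝ, SeqBox γ u → |(fun _ : ℕ → ℝ => (1 : ℝ)) u - 1| ≤ 0 * ∑' j, θ ^ j * u j := by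
  intro u _
  simp

/-- **EVERY BOX SOLUTION IS EXACT**: `MemFlow (fun _ => 1) e h` forces `1∕h(m)² = 1∕e² + m`. [folklore] -/
theorem const_invSq_eq {e : ℝ} {h : ℕ → ℝ} (hf : MemFlow (fun _ : ℕ → ℝ => (1 : ℝ)) e h) (m : ℕ) : 1 / h m ^ 2 = 1 / e ^ 2 + (m : ℝ) := by
  induction m with
  | zero => simp [hf.1]
  | succ m ih => rw [hf.2 m, ih]; push_cast; ring

/-- **THE Λ-COORDINATE IS EXACTLY `1∕g² − 1∕e′²`**: against the reference pin e′ (comparison sequence `a(n) = 1∕e′² + n`) the dynamical Abel function of part 44's interface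
is `Λ e = 1∕e² − 1∕e′²`, along EVERY box solution (the sequence is constant). [folklore] -/
theorem const_dynAbel {γ e' : ℝ} : ∀ e ∈ Ioc (0 : ℝ) e', ∀ h : ℕ → ℝ, SeqBox γ h → MemFlow (fun _ : ℕ → ℝ => (1 : ℝ)) e h →
    Tendsto (fun n => 1 / h n ^ 2 - (1 / e' ^ 2 + (n : ℝ))) atTop (𝓝 (1 / e ^ 2 - 1 / e' ^ 2)) := by
  intro e _ h _ hf
  refine tendsto_const_nhds.congr fun n => ?_
  rw [const_invSq_eq hf n]; ring

/-- `g ↦ 1∕g² − 1∕e′²` is strictly antitone on ]0, e′]. [folklore] -/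
theorem const_strictAntiOn {e' : ℝ} : StrictAntiOn (fun g : ℝ => 1 / g ^ 2 - 1 / e' ^ 2) (Ioc 0 e') := by
  intro a ha b hb hab
  have := one_div_lt_one_div_of_lt (pow_pos ha.1 2) (pow_lt_pow_left₀ hab ha.1.le two_ne_zero)
  show 1 / b ^ 2 - 1 / e' ^ 2 < 1 / a ^ 2 - 1 / e' ^ 2
  linarith

/-- … and onto `[0, ∞[` = `[Λ e′, ∞[`: the pin with Λ-value y is `1∕√(1∕e′² + y)`. [folklore] -/
theorem const_onto {e' : ℝ} (he' : 0 < e') :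
    ∀ y : ℝ, (1 / e' ^ 2 - 1 / e' ^ 2) ≤ y → ∃ x ∈ Ioc (0 : ℝ) e', 1 / x ^ 2 - 1 / e' ^ 2 = y := by
  intro y hy
  have hy0 : 0 ≤ y := by simpa using hy
  have hS : 0 < 1 / e' ^ 2 + y := by positivity
  refine ⟨1 / Real.sqrt (1 / e' ^ 2 + y), ⟨by positivity, ?_⟩, by rw [one_div_sq_one_div_sqrt hS]; ring⟩
  rw [div_le_iff₀ (Real.sqrt_pos.mpr hS)]
  calc (1 : ℝ) = Real.sqrt (e' ^ 2 * (1 / e' ^ 2)) := by rw [mul_one_div_cancel (pow_pos he' 2).ne', Real.sqrt_one]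
    _ ≤ Real.sqrt (e' ^ 2 * (1 / e' ^ 2 + y)) := Real.sqrt_le_sqrt (by nlinarith [pow_pos he' 2])
    _ = e' * Real.sqrt (1 / e' ^ 2 + y) := by rw [Real.sqrt_mul (sq_nonneg _), Real.sqrt_sq he'.le]

/-- EXACT CHART-ISOMETRY: part 44's defect `κ·g̃·Δ` (κ ∝ C_m = 0) vanishes identically. [folklore] -/
theorem const_isometry_exact {e' g g' : ℝ} :
    ((1 / g ^ 2 - 1 / e' ^ 2) - (1 / g' ^ 2 - 1 / e' ^ 2)) - (1 / g ^ 2 - 1 / g' ^ 2) = 0 := by ring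

/-- **THE CANONICAL CONTINUOUS RG OF THE TRIVIAL FLOW IS THE TEXTBOOK ONE-LOOP RUNNING COUPLING**: for `g ∈ ]0, e′]`, `s ≥ 0`, part 46's time-s map
`invFunOn Λ (Ioc 0 e′) (Λ g + s·1)` with `Λ = 1∕g² − 1∕e′²` equals **`1∕√(1∕g² + s)`** — `1∕φ_s(g)² = 1∕g² + s` on the nose; half a step is `1∕√(1∕g² + ½)`. [folklore] -/
theorem const_rg_eq {e' g s : ℝ} (hg : g ∈ Ioc (0 : ℝ) e') (hs : 0 ≤ s) :
    invFunOn (fun x : ℝ => 1 / x ^ 2 - 1 / e' ^ 2) (Ioc 0 e') ((1 / g ^ 2 - 1 / e' ^ 2) + s * 1) = 1 / Real.sqrt (1 / g ^ 2 + s) := by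
  have he' : 0 < e' := hg.1.trans_le hg.2
  obtain ⟨m₁, e₁⟩ := rg_mem_eq (Λ := fun x : ℝ => 1 / x ^ 2 - 1 / e' ^ 2) const_strictAntiOn (const_onto he') zero_le_one hg hs
  have hS : 0 < 1 / g ^ 2 + s := by have := hg.1; positivity
  -- the candidate lies in ]0, e′] (it is below g) and has the right Λ-value
  have hxg : 1 / Real.sqrt (1 / g ^ 2 + s) ≤ g := by
    rw [div_le_iff₀ (Real.sqrt_pos.mpr hS)]
    calc (1 : ℝ) = Real.sqrt (g ^ 2 * (1 / g ^ 2)) := by rw [mul_one_div_cancel (pow_pos hg.1 2).ne', Real.sqrt_one]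
      _ ≤ Real.sqrt (g ^ 2 * (1 / g ^ 2 + s)) := Real.sqrt_le_sqrt (by nlinarith [pow_pos hg.1 2])
      _ = g * Real.sqrt (1 / g ^ 2 + s) := by rw [Real.sqrt_mul (sq_nonneg _), Real.sqrt_sq hg.1.le]
  have hx : 1 / Real.sqrt (1 / g ^ 2 + s) ∈ Ioc (0 : ℝ) e' := ⟨by positivity, hxg.trans hg.2⟩
  have hval : (fun x : ℝ => 1 / x ^ 2 - 1 / e' ^ 2) (1 / Real.sqrt (1 / g ^ 2 + s)) = (1 / g ^ 2 - 1 / e' ^ 2) + s * 1 := by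
    show 1 / (1 / Real.sqrt (1 / g ^ 2 + s)) ^ 2 - 1 / e' ^ 2 = (1 / g ^ 2 - 1 / e' ^ 2) + s * 1
    rw [one_div_sq_one_div_sqrt hS]; ring
  exact (const_strictAntiOn.eq_iff_eq m₁ hx).mp (e₁.trans hval.symm) |>.symm

/-- THE CONTINUOUS CLOCK IN CLOSED FORM: `s·φ_s(g)² = s∕(1∕g² + s) → 1`. [folklore] -/
theorem const_clock {g : ℝ} (hg : 0 < g) : Tendsto (fun s : ℝ => s * (1 / Real.sqrt (1 / g ^ 2 + s)) ^ 2) atTop (𝓝 1) := by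
  -- `s∕(1∕g² + s) = 1∕((1∕g²)∕s + 1)` for s > 0, and `(1∕g²)∕s → 0`
  have h1 : Tendsto (fun s : ℝ => (1 / g ^ 2) / s + 1) atTop (𝓝 (0 + 1)) := (tendsto_const_nhds.div_atTop tendsto_id).add_const 1
  rw [zero_add] at h1
  have h2 := h1.inv₀ one_ne_zero
  rw [inv_one] at h2
  refine h2.congr' ?_
  filter_upwards [eventually_gt_atTop 0] with s hs
  have hS : 0 < 1 / g ^ 2 + s := by positivity
  rw [one_div_sq_one_div_sqrt hS |> fun h => show (1 / Real.sqrt (1 / g ^ 2 + s)) ^ 2 = 1 / (1 / g ^ 2 + s) by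
    rw [div_pow, one_pow, Real.sq_sqrt hS.le]]
  field_simp

end

end Summit.QuantumFields.BalabanUV.Beta.EriceFlowEnclosureB12AsPrintedHistoryContagionShiftFlowZeroSemigroupExact
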